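import Summits.ValiantsHypothesis.ValiantsHypothesis.Theorems.NcPartialDerivative
import Summits.ValiantsHypothesis.ValiantsHypothesis.Theorems.NcHankelIntervalModel
import HarnessLib

/-!
# The Hankel interval bound (FLOS20 Theorem 13 in the kernel) — H2b: span theorem + rank assembly

FLOS20 = Fijalkow–Lagarde–Ohlmann–Serre, STACS 2020. H2 of O-L6-20 = `NcHankelIntervalModel`
(designation `des`, zero-constant parse-tree model, designated sums `dsum` and their bilinear
expansion `dsum_pairPts`) + THIS FILE: the SPAN THEOREM (`dsum_mem_uptSpan`, by the prefix induction
`dsum_opPts_mem`; the rank-one heart of FLOS20 Theorem 5 WITHOUT pointed trees): the designated sum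
of the output's parse trees with `ℓ` leaves at `I = (a, m)` lies in the UPT span (`uptSpan`,
`frame_mem_uptSpan` of S4) of the degree-`m` components of the gate values (`bodies`) framed at
`(a, ℓ − a − m)`. If every `d`-leaf tree is designated, `f_d = Σ_{(a,m) ∈ [0,d]²} D(T(P); 0, d, (a,m))`
(`ptVal_filter_eq_sum_dsum`). RANK ASSEMBLY (`ivGood`, `rank_flat_dsum_le`, `hankel_interval_bound`
= FLOS20 Theorem 13): with `good (a, m) := bdist Y 1_{[a,a+m)} ≤ δ` each designated sum has
`rank M_Y ≤ n^δ · size` (`rank_flat_ivInd`, `rank_ivFlat_le_of_mem` of S4, distance lemma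
`rank_flat_le_of_bdist` = FLOS20 Lemma 9), hence `rank M_Y(f_d) ≤ (d+1)² · n^δ · size`.
MODEL (verbatim for every file): «Circuits ArithCircuit K σ read in FreeAlgebra K σ (ncEval), K a
field, σ finite; weighted sum gates of any fan-in, product gates of fan-in 1 or 2 (general fan-in:
the landed binz of O-L6-19); the INPUT circuit of a rung is const-free with non-constant output
(print: homogenisation, HWY10 §2 / LMS16 Lemma 4.2 — not formalised; same clause as
ncPerPoly_uptPrint); the instrument (H2) is proved in the wider ZERO-CONST model (const operands
allowed iff 0) so that block substitutions with vanishing entries stay inside it.» («zero-constant»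
hypotheses `hc`, `hp`, `ho` as in `ptVal_circuitPts₀`; §Span: any commutative semiring, any alphabet.)
print-KNOWN (FLOS20 Theorem 13; the rank-one heart of Theorem 5 without pointed trees) ·
kernel-NEW (no general-circuit parse-tree rank instrument in the tree) · INSTRUMENT ·
0 S-currency · closes NO item · A_nc stmt-23446 / PerNotNcVP / VP ≠ VNP untouched.
[cite: FijalkowLagardeOhlmannSerre2020, Theorem 5 (p. 7–8), Lemma 9 (p. 9), Theorem 13 (p. 12)]
[cite: LagardeLimayeSrinivasan2018, §2 (parse trees), §3 Lemma 9 (UPT span)]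
[cite: LimayeMalodSrinivasan2016, Theorem 1.3 (UPT rank method), Lemma 4.2]
[cite: HrubesWigdersonYehudayoff2010, §2 (homogeneous components, partial-derivative matrices)]
-/

noncomputable section

namespace Summit.ValiantsHypothesis.ValiantsHypothesis.Theorems.NcHankelIntervalBound

set_option linter.dupNamespace false
open Literature.Computability.AlgebraicComplexity
  Literature.Computability.AlgebraicComplexity.ArithCircuit
  Summit.ValiantsHypothesis.ValiantsHypothesis.Theorems.NcAutomatonIntersection
  Summit.ValiantsHypothesis.ValiantsHypothesis.Theorems.NcCentralWidth
  Summit.ValiantsHypothesis.ValiantsHypothesis.Theorems.NcSOSDegreeFour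
  Summit.ValiantsHypothesis.ValiantsHypothesis.Theorems.NcUniqueParseTree
  Summit.ValiantsHypothesis.ValiantsHypothesis.Theorems.NcUniqueParseTreeRank
  Summit.ValiantsHypothesis.ValiantsHypothesis.Theorems.NcParseTrees
  Summit.ValiantsHypothesis.ValiantsHypothesis.Theorems.NcParseTreeValues
  Summit.ValiantsHypothesis.ValiantsHypothesis.Theorems.NcPartialDerivative
  Summit.ValiantsHypothesis.ValiantsHypothesis.Theorems.NcHankelIntervalModel

universe u v

/-! ### §3 Designated sums and the span theorem -/

section Span

variable {R : Type u} [CommSemiring R] {σ : Type v}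

/-- The degree-`m` components (read with cap `d`) of the gate values: the BODIES (`degPart_idem` gives
the hypothesis `hB` of `rank_ivFlat_le_of_mem`). [cite: FijalkowLagardeOhlmannSerre2020, Theorem 5] -/
def bodies (P : ArithCircuit R σ) (d m : ℕ) : Set (FreeAlgebra R σ) :=
  {g | ∃ j, j < P.gates.length ∧ g = ((ncGateValues P.gates).map (degPart d m)).getD j 0}

/-- **Prefix induction for the span theorem** (generic cap `d`, offset `α`, body family `B`):
the designated sum at `I = (a, m)` of the parse trees of an operand over the gates `gs`, placed at
offset `α` with `ℓ ≤ d` leaves, lies in the UPT span of `B m` framed at `(a − α, ℓ − (a − α) − m)`,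
provided all degree components of the gate values lie in `B`. At a binary product gate: root good
⇒ the designated sum is the degree-`ℓ` component of the gate value (or `0`); otherwise it is
`Σ_{ℓ₁} (D(L; α, ℓ₁, I) · F(M; ℓ−ℓ₁) + U(L; α, ℓ₁) · D(M; α+ℓ₁, ℓ−ℓ₁, I))` and `frame_mem_uptSpan`
applies termwise. [cite: FijalkowLagardeOhlmannSerre2020, Theorem 5] -/
theorem dsum_opPts_mem (good : ℕ → ℕ → Bool) (gs : List (Gate R σ))
    (hc : ∀ g ∈ gs, ∀ u ∈ g.args, ∀ c, u = Operand.const c → c = 0)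
    (hp : ∀ args, Gate.prod args ∈ gs → args.length = 1 ∨ args.length = 2)
    {d : ℕ} (B : ℕ → Set (FreeAlgebra R σ))
    (hB : ∀ m j, j < gs.length → degPart d m ((ncGateValues gs).getD j 0) ∈ B m)
    (u : Operand R σ) {α ℓ a m : ℕ} (hℓ : ℓ ≤ d) (hα : α ≤ a) (ham : a + m ≤ α + ℓ) :
    dsum good (opPts (ptLists gs) u) α ℓ (a, m) ∈ uptSpan (B m) d (a - α) (ℓ - (a - α) - m) := by
  have hds_nil : ∀ (β k : ℕ) (I : ℕ × ℕ), dsum good ([] : List (Shape × FreeAlgebra R σ)) β k I = 0 :=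
    fun β k I => by simp [dsum, ptVal]
  have hds_app : ∀ (L M : List (Shape × FreeAlgebra R σ)) (β k : ℕ) (I : ℕ × ℕ),
      dsum good (L ++ M) β k I = dsum good L β k I + dsum good M β k I := fun L M β k I => by
    simp only [dsum, List.filter_append, ptVal_append]
  have hds_smul : ∀ (L : List (Shape × FreeAlgebra R σ)) (c : R) (β k : ℕ) (I : ℕ × ℕ),
      dsum good (L.map fun e => (e.1, c • e.2)) β k I = c • dsum good L β k I := fun L c β k I => by
    simp only [dsum, List.filter_map, Function.comp_def, ptVal_map_smul]
  have hds_leaf : ∀ (x : σ) (β k : ℕ) (I : ℕ × ℕ),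
      dsum good [(Shape.leaf, FreeAlgebra.ι R x)] β k I = 0 := fun x β k I => by
    unfold dsum; rw [List.filter_cons_of_neg, List.filter_nil]; exacts [by simp [ptVal], by simp [des]]
  have hvan : ∀ (L : List (Shape × FreeAlgebra R σ)) (β k a' m' : ℕ),
      ¬(β ≤ a' ∧ a' + m' ≤ β + k) → dsum good L β k (a', m') = 0 := by
    intro L β k a' m' hn
    have hnil : (L.filter fun e => e.1.size = k ∧ des good e.1 β = some (a', m')) = [] :=
      List.filter_eq_nil_iff.2 fun e _ hpe => by
        simp only [decide_eq_true_eq] at hpe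
        have hsp := des_spec hpe.2
        rw [hpe.1] at hsp
        exact hn ⟨hsp.2.2.1, hsp.2.2.2⟩
    unfold dsum; rw [hnil]; simp [ptVal]
  have hT : ∀ (L M : List (Shape × FreeAlgebra R σ)), ∀ x ∈ pairPts L M,
      ∃ e ∈ L, ∃ f ∈ M, x = (Shape.node e.1 f.1, e.2 * f.2) := by
    intro L M x hx
    induction L with
    | nil => simp [pairPts] at hx
    | cons e L ihL =>
      rw [pairPts, List.mem_append, List.mem_map] at hx
      rcases hx with ⟨f, hf, rfl⟩ | hx
      · exact ⟨e, by simp, f, hf, rfl⟩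
      · obtain ⟨e', he', f, hf, rfl⟩ := ihL hx
        exact ⟨e', List.mem_cons_of_mem _ he', f, hf, rfl⟩
  have hhom : ∀ (X : List (Shape × FreeAlgebra R σ)) (n : ℕ), n ≤ d →
      (∀ x ∈ X, ∃ c : R, ∃ w : List σ,
        w.length = x.1.size ∧ x.2 = c • (w.map (FreeAlgebra.ι R)).prod) →
      (∀ x ∈ X, x.1.size = n) → degPart d n (ptVal X) = ptVal X := by
    intro X n hn hX hsz
    rw [degPart_ptVal_filter X hX hn, List.filter_eq_self.2 fun x hx => decide_eq_true (hsz x hx)]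
  have hsumPts : ∀ (W : List (List (Shape × FreeAlgebra R σ))) (args : List (R × Operand R σ))
      (β k : ℕ) (I : ℕ × ℕ) (S : Submodule R (FreeAlgebra R σ)),
      (∀ x ∈ args, dsum good (opPts W x.2) β k I ∈ S) → dsum good (sumPts W args) β k I ∈ S := by
    intro W args β k I S h
    induction args with
    | nil => rw [sumPts, hds_nil]; exact zero_mem _
    | cons x rest ihr =>
      rw [sumPts, hds_app, hds_smul]
      exact add_mem (Submodule.smul_mem _ _ (h x (by simp)))
        (ihr fun y hy => h y (List.mem_cons_of_mem _ hy))
  have hlift : ∀ gs' : List (Gate R σ), (∀ (j β k a' m' : ℕ), k ≤ d → β ≤ a' → a' + m' ≤ β + k →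
      dsum good ((ptLists gs').getD j []) β k (a', m') ∈ uptSpan (B m') d (a' - β) (k - (a' - β) - m'))
      → ∀ (v : Operand R σ) (β k a' m' : ℕ), k ≤ d → β ≤ a' → a' + m' ≤ β + k →
        dsum good (opPts (ptLists gs') v) β k (a', m') ∈ uptSpan (B m') d (a' - β) (k - (a' - β) - m') := by
    intro gs' h v β k a' m' hk hβ hm
    cases v with
    | var x =>
      rw [show opPts (ptLists gs') (Operand.var x) = [(Shape.leaf, FreeAlgebra.ι R x)] from rfl,
        hds_leaf]
      exact zero_mem _
    | const c => rw [show opPts (ptLists gs') (Operand.const c) = [] from rfl, hds_nil]; exact zero_mem _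
    | gate i => exact h i β k a' m' hk hβ hm
  refine hlift gs ?_ u α ℓ a m hℓ hα ham
  induction gs using List.reverseRecOn with
  | nil =>
    intro j α ℓ a m _ _ _
    rw [show ptLists ([] : List (Gate R σ)) = [] from rfl, List.getD_nil, hds_nil]; exact zero_mem _
  | append_singleton gs g ih =>
    intro j α ℓ a m hℓ hα ham
    have hc' : ∀ g' ∈ gs, ∀ u ∈ g'.args, ∀ c, u = Operand.const c → c = 0 :=
      fun g' hg' => hc g' (List.mem_append_left _ hg')
    have hp' : ∀ args, Gate.prod args ∈ gs → args.length = 1 ∨ args.length = 2 :=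
      fun args h => hp args (List.mem_append_left _ h)
    have hB' : ∀ m j, j < gs.length → degPart d m ((ncGateValues gs).getD j 0) ∈ B m :=
      fun m j hj => by
        rw [← (ncGateValues_append_getD gs [g]).2 j hj]
        exact hB m j (by rw [List.length_append, List.length_singleton]; omega)
    have ih' := ih hc' hp' hB'; have hop := hlift gs ih'
    rcases Nat.lt_trichotomy j gs.length with hj | rfl | hj
    · rw [ptLists_getD_append gs [g] hj]
      exact ih' j α ℓ a m hℓ hα ham
    · rw [ptLists_append_singleton, List.getD_append_right _ _ _ _ (length_ptLists gs).le,
        length_ptLists, Nat.sub_self, List.getD_cons_zero]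
      rcases g with args | (_ | ⟨u, _ | ⟨u', _ | ⟨u'', rest⟩⟩⟩)
      · simp only [gatePts]
        exact hsumPts _ args α ℓ (a, m) _ fun x _ => hop x.2 α ℓ a m hℓ hα ham
      · rw [show gatePts (ptLists gs) (Gate.prod []) = [] from rfl, hds_nil]; exact zero_mem _
      · simp only [gatePts]
        exact hop u α ℓ a m hℓ hα ham
      · -- the binary product gate
        simp only [gatePts]
        have hW := ptVal_ptLists₀ gs hc' hp'
        have hgm : Gate.prod [u, u'] ∈ gs ++ [Gate.prod [u, u']] :=
          List.mem_append_right gs (List.mem_singleton_self _)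
        have hu : ∀ c, u = Operand.const c → c = 0 := hc _ hgm u (by simp [Gate.args])
        have hu' : ∀ c, u' = Operand.const c → c = 0 := hc _ hgm u' (by simp [Gate.args])
        have hbody : ∀ k,
            degPart d k (ptVal (opPts (ptLists gs) u) * ptVal (opPts (ptLists gs) u')) ∈ B k := by
          intro k
          rw [ptVal_opPts₀ hW u hu, ptVal_opPts₀ hW u' hu']
          have h := hB k gs.length (by rw [List.length_append, List.length_singleton]; omega)
          rw [ncGateValues_getD_length] at h
          simpa only [Gate.ncEval, List.map_cons, List.map_nil, List.prod_cons, List.prod_nil,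
            mul_one] using h
        have hwT : ∀ x ∈ pairPts (opPts (ptLists gs) u) (opPts (ptLists gs) u'), ∃ c : R,
            ∃ w : List σ, w.length = x.1.size ∧ x.2 = c • (w.map (FreeAlgebra.ι R)).prod :=
          fun x hx => opPts_word (gs ++ [Gate.prod [u, u']]) (Operand.gate gs.length) x (by
            show x ∈ (ptLists (gs ++ [Gate.prod [u, u']])).getD gs.length []
            rw [ptLists_append_singleton, List.getD_append_right _ _ _ _ (length_ptLists gs).le,
              length_ptLists, Nat.sub_self, List.getD_cons_zero]
            exact hx)
        have hwL := opPts_word gs u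
        have hwM := opPts_word gs u'
        have hmL := hop u
        have hmM := hop u'
        revert hbody hwT hwL hwM hmL hmM
        generalize opPts (ptLists gs) u = L
        generalize opPts (ptLists gs) u' = M
        intro hbody hwT hwL hwM hmL hmM
        by_cases hg : good α ℓ = true
        · -- the root is the designated node (or nothing is designated at `(a, m)`)
          by_cases hI : a = α ∧ m = ℓ
          · obtain ⟨hI1, hI2⟩ := hI
            rw [hI1, hI2, Nat.sub_self, Nat.sub_zero, Nat.sub_self]
            have hT0 : dsum good (pairPts L M) α ℓ (α, ℓ) = degPart d ℓ (ptVal L * ptVal M) := by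
              rw [← ptVal_pairPts, degPart_ptVal_filter (pairPts L M) hwT hℓ]
              unfold dsum
              congr 1
              refine List.filter_congr fun x hx => ?_
              obtain ⟨e, -, f, -, rfl⟩ := hT L M x hx
              simp only [decide_eq_decide, Shape.size, des]
              constructor
              · exact fun h => h.1
              · intro h
                exact ⟨h, by rw [h, if_pos hg]⟩
            rw [hT0]
            unfold uptSpan
            exact Submodule.subset_span ⟨_, 1, 1, hbody ℓ, degPart_zero_one d, degPart_zero_one d,
              by rw [one_mul, mul_one]⟩
          · have hnil : ((pairPts L M).filter
                fun e => e.1.size = ℓ ∧ des good e.1 α = some (a, m)) = [] :=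
              List.filter_eq_nil_iff.2 fun x hx hdx => by
                obtain ⟨e, -, f, -, rfl⟩ := hT L M x hx
                simp only [decide_eq_true_eq, Shape.size, des] at hdx
                obtain ⟨hs, hd⟩ := hdx
                rw [hs, if_pos hg, Option.some.injEq, Prod.mk.injEq] at hd
                exact hI ⟨hd.1.symm, hd.2.symm⟩
            rw [show dsum good (pairPts L M) α ℓ (a, m) = 0 by unfold dsum; rw [hnil]; simp [ptVal]]
            exact zero_mem _
        · -- the designated node is below the root: expand bilinearly and frame each term
          rw [dsum_pairPts good L M (eq_false_of_ne_true hg) (a, m)]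
          refine Submodule.sum_mem _ fun n hn => ?_
          rw [Finset.mem_range] at hn; refine add_mem ?_ ?_
          · by_cases hz : a + m ≤ α + n
            · have h1 := hmL α n a m (by omega) hα hz
              have hF := hhom (M.filter fun f => f.1.size = ℓ - n) (ℓ - n) (by omega)
                (fun x hx => hwM x (List.mem_filter.1 hx).1)
                (fun x hx => of_decide_eq_true (List.mem_filter.1 hx).2)
              have h2 := frame_mem_uptSpan h1 (degPart_zero_one d) hF (by omega) (by omega)
              rw [one_mul, zero_add,
                show n - (a - α) - m + (ℓ - n) = ℓ - (a - α) - m by omega] at h2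
              exact h2
            · rw [hvan L α n a m (fun h => hz h.2), zero_mul]
              exact zero_mem _
          · by_cases hz : α + n ≤ a
            · have h1 := hmM (α + n) (ℓ - n) a m (by omega) hz (by omega)
              have hU := hhom (L.filter fun e => e.1.size = n ∧ des good e.1 α = none) n
                (by omega) (fun x hx => hwL x (List.mem_filter.1 hx).1)
                (fun x hx => (of_decide_eq_true (List.mem_filter.1 hx).2).1)
              have h2 := frame_mem_uptSpan h1 hU (degPart_zero_one d) (by omega) (by omega)
              rw [mul_one, add_zero, show n + (a - (α + n)) = a - α by omega,
                show ℓ - n - (a - (α + n)) - m = ℓ - (a - α) - m by omega] at h2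
              exact h2
            · rw [hvan M (α + n) (ℓ - n) a m (fun h => hz h.1), mul_zero]
              exact zero_mem _
      · rw [show gatePts (ptLists gs) (Gate.prod (u :: u' :: u'' :: rest)) = [] from rfl, hds_nil]
        exact zero_mem _
    · have h1 : (ptLists (gs ++ [g])).length ≤ j := by
        rw [length_ptLists, List.length_append, List.length_singleton]; omega
      rw [List.getD_eq_default _ _ h1, hds_nil]; exact zero_mem _

/-- **SPAN THEOREM** (the rank-one heart of FLOS20 Thm 5/13 WITHOUT pointed trees): the designated
sum of the output's parse trees with `ℓ` leaves at the interval `I = (a, m)` lies in the UPT span of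
the bodies of degree `m` framed at `(a, ℓ − a − m)` — by prefix induction over the gates: root good ⇒
the body is the degree-`ℓ` component of the gate value; designated on the left ⇒ IH · homogeneous;
designated on the right ⇒ (undesignated left part, homogeneous) · IH.
[cite: FijalkowLagardeOhlmannSerre2020, Theorem 5] -/
theorem dsum_mem_uptSpan (good : ℕ → ℕ → Bool) (P : ArithCircuit R σ)
    (hc : ∀ g ∈ P.gates, ∀ u ∈ g.args, ∀ c, u = Operand.const c → c = 0)
    (hp : ∀ args, Gate.prod args ∈ P.gates → args.length = 1 ∨ args.length = 2) {ℓ a m : ℕ}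
    (ham : a + m ≤ ℓ) :
    dsum good (circuitPts P) 0 ℓ (a, m) ∈ uptSpan (bodies P ℓ m) ℓ a (ℓ - a - m) := by
  have h : dsum good (opPts (ptLists P.gates) P.output) 0 ℓ (a, m) ∈
      uptSpan (bodies P ℓ m) ℓ (a - 0) (ℓ - (a - 0) - m) :=
    dsum_opPts_mem good P.gates hc hp (bodies P ℓ) (fun m j hj =>
      ⟨j, hj, by rw [← List.getD_map (ncGateValues P.gates) 0 (degPart ℓ m), map_zero]⟩)
      P.output le_rfl (Nat.zero_le a) (by rw [Nat.zero_add]; exact ham)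
  rw [Nat.sub_zero] at h; exact h

/-- Every `d`-leaf parse tree designated ⇒ `f_d = Σ_{(a,m) ∈ [0,d]²} D(T(P); 0, d, (a,m))`.
[cite: FijalkowLagardeOhlmannSerre2020, Theorem 5] -/
theorem ptVal_filter_eq_sum_dsum (good : ℕ → ℕ → Bool) (P : ArithCircuit R σ) (d : ℕ)
    (hdes : ∀ e ∈ circuitPts P, e.1.size = d → des good e.1 0 ≠ none) :
    ptVal ((circuitPts P).filter fun e => e.1.size = d) =
      ∑ I ∈ Finset.range (d + 1) ×ˢ Finset.range (d + 1), dsum good (circuitPts P) 0 d I := by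
  revert hdes
  generalize circuitPts P = L
  intro hdes
  induction L with
  | nil => simp [dsum, ptVal]
  | cons e L ih =>
    have hcons : ∀ (p : Shape × FreeAlgebra R σ → Prop) [DecidablePred p]
        (X : List (Shape × FreeAlgebra R σ)),
        ptVal ((e :: X).filter fun x => p x) = (if p e then e.2 else 0) + ptVal (X.filter fun x => p x) := by
      intro p _ X; rw [List.filter_cons]
      by_cases h : p e
      · rw [if_pos (decide_eq_true h), if_pos h]; simp [ptVal]
      · rw [if_neg (mt of_decide_eq_true h), if_neg h, zero_add]
    have hcD : ∀ I : ℕ × ℕ, dsum good (e :: L) 0 d I =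
        (if e.1.size = d ∧ des good e.1 0 = some I then e.2 else 0) + dsum good L 0 d I :=
      fun I => hcons _ L
    have hc0 : ptVal ((e :: L).filter fun x => x.1.size = d) =
        (if e.1.size = d then e.2 else 0) + ptVal (L.filter fun x => x.1.size = d) := hcons _ L
    rw [hc0, Finset.sum_congr rfl fun I _ => hcD I, Finset.sum_add_distrib,
      ← ih fun x hx => hdes x (List.mem_cons_of_mem _ hx)]
    congr 1
    by_cases hsd : e.1.size = d
    · obtain ⟨⟨a₀, m₀⟩, hI₀⟩ := Option.ne_none_iff_exists'.1 (hdes e (by simp) hsd)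
      obtain ⟨-, -, -, hle⟩ := des_spec hI₀
      have hmem : (a₀, m₀) ∈ Finset.range (d + 1) ×ˢ Finset.range (d + 1) :=
        Finset.mem_product.2
          ⟨Finset.mem_range.2 (show a₀ < d + 1 by omega), Finset.mem_range.2 (show m₀ < d + 1 by omega)⟩
      rw [if_pos hsd, Finset.sum_eq_single_of_mem (a₀, m₀) hmem fun I _ hI => ?_]
      · rw [if_pos (And.intro hsd hI₀)]
      · have hne : ¬(e.1.size = d ∧ des good e.1 0 = some I) := by
          rintro ⟨-, h⟩; rw [hI₀] at h; exact hI (Option.some.inj h).symm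
        rw [if_neg hne]
    · rw [if_neg hsd]
      symm
      refine Finset.sum_eq_zero fun I _ => ?_
      exact if_neg fun h => hsd h.1

end Span

/-! ### §4 The Hankel interval bound (FLOS20 Theorem 13) -/

section Main

variable (K : Type u) [Field K] {σ : Type v} [Fintype σ] [DecidableEq σ]

/-- Good intervals w.r.t. a position set `A` and a slack `δ`: `dist(A, [a, a+m)) ≤ δ`.
[cite: FijalkowLagardeOhlmannSerre2020, Theorem 13] -/
def ivGood {d : ℕ} (Y : Fin d → Bool) (δ : ℕ) : ℕ → ℕ → Bool :=
  fun a m => decide (bdist Y (ivInd d a m) ≤ δ)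

/-- Rank of ONE designated sum: `rank M_A(D(a,m)) ≤ n^δ · size` (`dsum_mem_uptSpan` +
`rank_ivFlat_le_of_mem` + `rank_flat_ivInd` + the distance lemma).
[cite: FijalkowLagardeOhlmannSerre2020, Theorem 13] -/
theorem rank_flat_dsum_le (P : ArithCircuit K σ)
    (hc : ∀ g ∈ P.gates, ∀ u ∈ g.args, ∀ c, u = Operand.const c → c = 0)
    (hp : ∀ args, Gate.prod args ∈ P.gates → args.length = 1 ∨ args.length = 2) {d : ℕ}
    (Y : Fin d → Bool) (δ : ℕ) (I : ℕ × ℕ) :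
    (flat K Y (dsum (ivGood Y δ) (circuitPts P) 0 d I)).rank ≤ Fintype.card σ ^ δ * P.size := by
  obtain ⟨a, m⟩ := I
  by_cases h0 : dsum (ivGood Y δ) (circuitPts P) 0 d (a, m) = 0
  · rw [h0, map_zero, Matrix.rank_zero]; exact Nat.zero_le _
  have hne : ((circuitPts P).filter
      fun e => e.1.size = d ∧ des (ivGood Y δ) e.1 0 = some (a, m)) ≠ [] := by
    intro hnil; apply h0; unfold dsum; rw [hnil]; simp [ptVal]
  obtain ⟨e, he⟩ := List.exists_mem_of_ne_nil _ hne
  rw [List.mem_filter, decide_eq_true_eq] at he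
  obtain ⟨hemem, hsz, hde⟩ := he
  obtain ⟨hgood, h2m, -, hle⟩ := des_spec hde
  have hδ : bdist Y (ivInd d a m) ≤ δ := by simpa [ivGood] using hgood
  obtain ⟨-, w, hw, -⟩ := opPts_word P.gates P.output e hemem
  obtain ⟨x, -⟩ := List.exists_mem_of_length_pos (l := w) (by omega)
  haveI : Nonempty σ := ⟨x⟩
  have hadm : a + m ≤ d := by omega
  obtain ⟨b, hb⟩ : ∃ b, d = a + m + b := ⟨d - (a + m), by omega⟩; subst hb
  have hmem := dsum_mem_uptSpan (ivGood Y δ) P hc hp (ℓ := a + m + b) (a := a) (m := m) hadm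
  rw [show a + m + b - a - m = b by omega] at hmem
  have hlenNc : (ncGateValues P.gates).length = P.gates.length := by
    have h := (ncGateValues_append_getD P.gates []).1
    rw [List.append_nil, List.length_nil, Nat.add_zero] at h; exact h
  have hrk : (ivFlat K a m b (dsum (ivGood Y δ) (circuitPts P) 0 (a + m + b) (a, m))).rank ≤
      P.size := by
    have h := rank_ivFlat_le_of_mem K (a := a) (ℓ := m) (b := b) (d := a + m + b) le_rfl
      ((ncGateValues P.gates).map (degPart (a + m + b) m)) (B := bodies P (a + m + b) m)
      (fun g hg => by
        obtain ⟨j, hj, hgj⟩ := hg; exact ⟨j, by rw [List.length_map, hlenNc]; exact hj, hgj⟩)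
      (fun g hg => by
        obtain ⟨j, -, hgj⟩ := hg
        rw [hgj, ← map_zero (degPart (R := K) (σ := σ) (a + m + b) m), List.getD_map, degPart_idem]) hmem
    rw [List.length_map, hlenNc] at h; exact h
  refine (rank_flat_le_of_bdist K Y (ivInd (a + m + b) a m) _).trans ?_
  rw [rank_flat_ivInd]
  exact Nat.mul_le_mul (Nat.pow_le_pow_right Fintype.card_pos hδ) hrk

/-- ★ **HANKEL INTERVAL BOUND** (FLOS20 Theorem 13 in the kernel): if every parse tree of `P` with `d`
leaves has an internal node whose interval is `δ`-close to `A` or to `Aᶜ`, then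
`rank M_A(f_d) ≤ (d+1)² · n^δ · size(P)`, `f_d` the degree-`d` component of the computed polynomial.
MODEL: binary zero-constant circuits (products of fan-in 1 or 2, const operands only `0`).
[cite: FijalkowLagardeOhlmannSerre2020, Theorem 13] -/
theorem hankel_interval_bound (P : ArithCircuit K σ)
    (hc : ∀ g ∈ P.gates, ∀ u ∈ g.args, ∀ c, u = Operand.const c → c = 0)
    (hp : ∀ args, Gate.prod args ∈ P.gates → args.length = 1 ∨ args.length = 2)
    (ho : ∀ c, P.output = Operand.const c → c = 0) {d : ℕ} (Y : Fin d → Bool) (δ : ℕ)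
    (hdes : ∀ e ∈ circuitPts P, e.1.size = d → des (ivGood Y δ) e.1 0 ≠ none) :
    (flat K Y (degPart d d P.ncEval)).rank ≤ (d + 1) ^ 2 * Fintype.card σ ^ δ * P.size := by
  rw [degPart_ncEval_eq_ptVal_filter P hc hp ho d, ptVal_filter_eq_sum_dsum (ivGood Y δ) P d hdes]
  refine (rank_flat_sum_le K _ Y _).trans ?_
  calc ∑ I ∈ Finset.range (d + 1) ×ˢ Finset.range (d + 1),
        (flat K Y (dsum (ivGood Y δ) (circuitPts P) 0 d I)).rank
      ≤ ∑ I ∈ Finset.range (d + 1) ×ˢ Finset.range (d + 1), Fintype.card σ ^ δ * P.size :=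
        Finset.sum_le_sum fun I _ => rank_flat_dsum_le K P hc hp Y δ I
    _ = (d + 1) ^ 2 * Fintype.card σ ^ δ * P.size := by
        rw [Finset.sum_const, Finset.card_product, Finset.card_range, smul_eq_mul]; ring

end Main

end Summit.ValiantsHypothesis.ValiantsHypothesis.Theorems.NcHankelIntervalBound
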